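import Summits.NavierStokesRegularity.NavierStokesRegularity.Theorems.SoloRefuteAbuGhuwaleh2026bSmallC

/-!
# C61b `AbuGhuwaleh2026b` — the three rev-2 claim Steps closed in the kernel (all REFUTED)

Skeleton rev 2 (p497123 @ 9f196aa7282f, typist-6 g3) added three named claim Steps to
`Literature/Claims/NS/AbuGhuwaleh2026b.lean`: the print-faithful small-cutoff forms
`Step2_Thm42_2425_small` / `Step2L_Thm42_25a_small` (REF ref-1 g3 RETYPE.md §2 R#1: «c_* > 0
sufficiently small and fixed once and for all», p.2 l.20–25) and the thin-class face
`Step2T_Thm42_25a` ((25) first half per direction class of FIXED aperture, p.9 l.77–90, §6.1 p.19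
l.14). This file negates all three BY NAME:
* `not_Step2_Thm42_2425_small_tree`, `not_Step2L_Thm42_25a_small_tree` — definitional bridges to
  the landed inline refutations `not_Step2_Thm42_2425_small` / `not_Step2L_Thm42_25a_small`
  (p497188, `SoloRefuteAbuGhuwaleh2026bSmallC.lean`; the tree Props are character-identical);
* `not_Step2T_Thm42_25a` (+ `not_thinClass_bound` at every fixed aperture `1/s`) — typist-6 g3's
  kit `SoloRefuteAbuGhuwaleh2026bThin.typist6-kit.lean` (sha16 c404ff044d0306f5) ported verbatim
  from its `Mirror` copies to the tree decls: inside the square-cone `{p₁ > 0, s|p₂| ≤ p₁, s|p₃| ≤ p₁}`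
  the lattice box `p₁ ∈ [2t³, 4t³]`, `|p₂|,|p₃| ≤ 2s²r³` (`t = sr`) lies in the low ball
  `|p| ≤ 8t³ = (16t⁴)^{3/4}` and has `N ≥ 32 s⁷r⁹` points; the flat array gives `N² ≤ C R² N`, i.e.
  `r ≤ 8|C|s` — false for `r = 8s(⌈|C|⌉+1)`. So no finite family of cones of fixed aperture rescues
  (25): only apertures `≍ R^{-1/8}` (`≍ R^{1/4}` classes, excluded by §6.1 p.19) would.
Token of ADJUDICATED #114 unchanged (first failing step `Step2_Thm42_2425`, `not_Step2_Thm42_2425`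
p495906). [cite: AbuGhuwaleh2026b, Thm 4.2 (24)–(25) p.10; p.11 l.1–9; p.2 l.20–25; §4 p.9 l.77–90;
§6.1 p.19 l.14]

WHAT THIS IS NOT: not a claim about NS regularity or blow-up; not a claim about any author beyond
the typed locator.
-/

set_option linter.dupNamespace false

open Finset Literature.Analysis.FunctionSpaces

namespace Summit.NavierStokesRegularity.NavierStokesRegularity.Theorems.AbuGhuwaleh2026b

open Literature.Claims.NS.AbuGhuwaleh2026b

/-! ### The small-cutoff Steps of rev 2, by name -/

/-- **¬ `Step2_Thm42_2425_small`** (tree decl, rev 2 p497123) — the print-faithful «c_* sufficiently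
small» form of Theorem 4.2 (24)–(25) is false: definitionally the landed
`not_Step2_Thm42_2425_small` (p497188). [cite: AbuGhuwaleh2026b, Thm 4.2 (24)–(25) p.10; p.2 l.20–25] -/
theorem not_Step2_Thm42_2425_small_tree :
    ¬ Literature.Claims.NS.AbuGhuwaleh2026b.Step2_Thm42_2425_small :=
  not_Step2_Thm42_2425_small

/-- **¬ `Step2L_Thm42_25a_small`** (tree decl, rev 2 p497123) — the print-faithful «c_* sufficiently
small» form of (25) first half is false: definitionally the landed `not_Step2L_Thm42_25a_small`
(p497188). [cite: AbuGhuwaleh2026b, Thm 4.2 (25) p.10; p.2 l.20–25] -/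
theorem not_Step2L_Thm42_25a_small_tree :
    ¬ Literature.Claims.NS.AbuGhuwaleh2026b.Step2L_Thm42_25a_small :=
  not_Step2L_Thm42_25a_small

noncomputable section

/-! ### Integer boxes (as in the typist kit 973bb48c59cf6011) -/

/-- The lattice box `{x ∈ ℤ³ : lo_i ≤ x_i ≤ hi_i}`. [folklore] -/
def box (lo hi : Z3) : Finset Z3 := Fintype.piFinset fun i => Finset.Icc (lo i) (hi i)

/-- Membership in a box. [folklore] -/
theorem mem_box {lo hi x : Z3} : x ∈ box lo hi ↔ ∀ i, lo i ≤ x i ∧ x i ≤ hi i := by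
  simp [box, Fintype.mem_piFinset, Finset.mem_Icc]

/-- Cardinality of a non-degenerate box. [folklore] -/
theorem card_box (lo hi : Z3) (h : ∀ i, lo i ≤ hi i) :
    ((box lo hi).card : ℝ) = ∏ i, ((hi i : ℝ) - lo i + 1) := by
  have hz : ((box lo hi).card : ℤ) = ∏ i, (hi i - lo i + 1) := by
    rw [box, Fintype.card_piFinset]
    push_cast
    refine Finset.prod_congr rfl fun i _ => ?_
    rw [Int.card_Icc, Int.toNat_of_nonneg (by have := h i; omega)]
    ring
  have := congrArg (fun z : ℤ => (z : ℝ)) hz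
  push_cast at this
  exact this

/-- `(16 t⁴)^{3/4} = 8 t³` for `t ≥ 0`. [folklore] -/
theorem rpow_sixteen (T : ℝ) (hT : 0 ≤ T) : (16 * T ^ 4) ^ (3 / 4 : ℝ) = 8 * T ^ 3 := by
  have h2 : (0 : ℝ) ≤ 2 * T := by positivity
  have e : (16 : ℝ) * T ^ 4 = (2 * T) ^ (4 : ℝ) := by
    rw [show (4 : ℝ) = ((4 : ℕ) : ℝ) by norm_num, Real.rpow_natCast]; ring
  rw [e, ← Real.rpow_mul h2, show (4 : ℝ) * (3 / 4) = ((3 : ℕ) : ℝ) by norm_num, Real.rpow_natCast]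
  ring

/-! ### The thin box -/

/-- The box `p₁ ∈ [2T, 4T]`, `|p₂|, |p₃| ≤ 2M` (used with `T = t³ = s³r³`, `M = s²r³`). [folklore] -/
def thinBox (T M : ℕ) : Finset Z3 :=
  box ![2 * (T : ℤ), -(2 * (M : ℤ)), -(2 * (M : ℤ))] ![4 * (T : ℤ), 2 * (M : ℤ), 2 * (M : ℤ)]

/-- `#thinBox = (2T+1)(4M+1)²`. [folklore] -/
theorem card_thinBox (T M : ℕ) :
    ((thinBox T M).card : ℝ) = (2 * (T : ℝ) + 1) * (4 * (M : ℝ) + 1) ^ 2 := by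
  have h : ∀ i, (![2 * (T : ℤ), -(2 * (M : ℤ)), -(2 * (M : ℤ))] : Z3) i ≤
      (![4 * (T : ℤ), 2 * (M : ℤ), 2 * (M : ℤ)] : Z3) i := by
    intro i
    fin_cases i
    · simp; omega
    · simp
    · simp
  rw [thinBox, card_box _ _ h]
  simp [Fin.prod_univ_three]
  ring

/-- The thin box lies in the thin class of aperture `1/s` when `s·M ≤ T` and `1 ≤ T`. [folklore] -/
theorem thinBox_thin {s T M : ℕ} (hsM : s * M ≤ T) (hT : 1 ≤ T) :
    ∀ p ∈ thinBox T M, p ∈ thinClass s := by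
  intro p hp
  rw [thinBox, mem_box] at hp
  have h0 := hp 0; have h1 := hp 1; have h2 := hp 2
  clear hp
  simp at h0 h1 h2
  have hsM' : (s : ℤ) * (M : ℤ) ≤ (T : ℤ) := by exact_mod_cast hsM
  have hs0 : (0 : ℤ) ≤ (s : ℤ) := by positivity
  have a1 : |p 1| ≤ 2 * (M : ℤ) := abs_le.2 ⟨by linarith [h1.1], h1.2⟩
  have a2 : |p 2| ≤ 2 * (M : ℤ) := abs_le.2 ⟨by linarith [h2.1], h2.2⟩
  show 0 < p 0 ∧ (s : ℤ) * |p 1| ≤ p 0 ∧ (s : ℤ) * |p 2| ≤ p 0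
  refine ⟨by omega, ?_, ?_⟩
  · calc (s : ℤ) * |p 1| ≤ (s : ℤ) * (2 * (M : ℤ)) := mul_le_mul_of_nonneg_left a1 hs0
      _ = 2 * ((s : ℤ) * (M : ℤ)) := by ring
      _ ≤ p 0 := by linarith [h0.1]
  · calc (s : ℤ) * |p 2| ≤ (s : ℤ) * (2 * (M : ℤ)) := mul_le_mul_of_nonneg_left a2 hs0
      _ = 2 * ((s : ℤ) * (M : ℤ)) := by ring
      _ ≤ p 0 := by linarith [h0.1]

/-- The thin box lies in the low ball `|p| ≤ 8t³ = (16t⁴)^{3/4}` when `T = t³` and `M ≤ T`. [folklore] -/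
theorem thinBox_low {t T M : ℕ} (hT : T = t ^ 3) (hM : M ≤ T) :
    ∀ p ∈ thinBox T M, lnorm p ≤ 1 * (16 * (t : ℝ) ^ 4) ^ (3 / 4 : ℝ) := by
  intro p hp
  have ht0 : (0 : ℝ) ≤ t := by positivity
  rw [one_mul, rpow_sixteen _ ht0, lnorm]
  rw [thinBox, mem_box] at hp
  have h0 := hp 0; have h1 := hp 1; have h2 := hp 2
  clear hp
  simp at h0 h1 h2
  have hTR : (T : ℝ) = (t : ℝ) ^ 3 := by rw [hT]; push_cast; ring
  have hMR : (M : ℝ) ≤ (T : ℝ) := by exact_mod_cast hM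
  have hM0 : (0 : ℝ) ≤ (M : ℝ) := by positivity
  have a0 : (2 : ℝ) * T ≤ (p 0 : ℝ) := by exact_mod_cast h0.1
  have b0 : (p 0 : ℝ) ≤ 4 * T := by exact_mod_cast h0.2
  have a1 : -(2 * (M : ℝ)) ≤ (p 1 : ℝ) := by exact_mod_cast h1.1
  have b1 : (p 1 : ℝ) ≤ 2 * M := by exact_mod_cast h1.2
  have a2 : -(2 * (M : ℝ)) ≤ (p 2 : ℝ) := by exact_mod_cast h2.1
  have b2 : (p 2 : ℝ) ≤ 2 * M := by exact_mod_cast h2.2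
  have e : Torus.freqNormSq p = (p 0 : ℝ) ^ 2 + (p 1 : ℝ) ^ 2 + (p 2 : ℝ) ^ 2 := by
    unfold Torus.freqNormSq; simp [Fin.sum_univ_three]
  have hsq : Torus.freqNormSq p ≤ (8 * (t : ℝ) ^ 3) ^ 2 := by
    rw [e, ← hTR]
    have hT0 : (0 : ℝ) ≤ (T : ℝ) := by positivity
    have q0 : (p 0 : ℝ) ^ 2 ≤ (4 * (T : ℝ)) ^ 2 := by nlinarith
    have q1 : (p 1 : ℝ) ^ 2 ≤ (2 * (M : ℝ)) ^ 2 := sq_le_sq' a1 b1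
    have q2 : (p 2 : ℝ) ^ 2 ≤ (2 * (M : ℝ)) ^ 2 := sq_le_sq' a2 b2
    nlinarith
  calc Real.sqrt (Torus.freqNormSq p) ≤ Real.sqrt ((8 * (t : ℝ) ^ 3) ^ 2) := Real.sqrt_le_sqrt hsq
    _ = 8 * (t : ℝ) ^ 3 := Real.sqrt_sq (by positivity)

/-! ### The bound and the kill -/

/-- The thin-class inequality at aperture `1/s` forces `r ≤ 8|C|s` for every `r ≥ 1`. [folklore] -/
theorem thin_bound (C : ℝ) (s : ℕ) (hs : 1 ≤ s)
    (hC : ∀ R : ℝ, 1 ≤ R → ∀ (A : Finset Z3) (a : Z3 → ℝ),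
      (∀ p ∈ A, lnorm p ≤ 1 * R ^ (3 / 4 : ℝ)) → (∀ p ∈ A, p ∈ thinClass s) →
        (∑ p ∈ A, |a p|) ^ 2 ≤ C * R ^ 2 * ∑ p ∈ A, a p ^ 2)
    (r : ℕ) (hr : 1 ≤ r) : (r : ℝ) ≤ 8 * |C| * s := by
  have hS1 : (1 : ℝ) ≤ s := by exact_mod_cast hs
  have hR1' : (1 : ℝ) ≤ r := by exact_mod_cast hr
  have hS0 : (0 : ℝ) ≤ s := by positivity
  have hr0 : (0 : ℝ) ≤ r := by positivity
  -- t = s r, T = t³, M = s² r³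
  have hsM : s * (s ^ 2 * r ^ 3) ≤ (s * r) ^ 3 := by
    have : s * (s ^ 2 * r ^ 3) = (s * r) ^ 3 := by ring
    omega
  have hT1 : 1 ≤ (s * r) ^ 3 := Nat.one_le_pow _ _ (Nat.mul_pos hs hr)
  have hM : s ^ 2 * r ^ 3 ≤ (s * r) ^ 3 := by
    calc s ^ 2 * r ^ 3 ≤ s * (s ^ 2 * r ^ 3) := Nat.le_mul_of_pos_left _ hs
      _ ≤ (s * r) ^ 3 := hsM
  have hR1 : (1 : ℝ) ≤ 16 * ((s * r : ℕ) : ℝ) ^ 4 := by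
    have h1 : (1 : ℝ) ≤ ((s * r : ℕ) : ℝ) := by exact_mod_cast Nat.mul_pos hs hr
    nlinarith [one_le_pow₀ (n := 4) h1]
  have key := hC _ hR1 (thinBox ((s * r) ^ 3) (s ^ 2 * r ^ 3)) (fun _ => (1 : ℝ))
    (thinBox_low rfl hM) (thinBox_thin hsM hT1)
  simp only [abs_one, one_pow, Finset.sum_const, nsmul_eq_mul, mul_one] at key
  rw [card_thinBox] at key
  push_cast at key
  -- key : N ^ 2 ≤ C * (16 (s r)^4)^2 * N with N = (2 (s r)^3 + 1) (4 s² r³ + 1)²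
  set N : ℝ := (2 * ((s : ℝ) * r) ^ 3 + 1) * (4 * ((s : ℝ) ^ 2 * (r : ℝ) ^ 3) + 1) ^ 2 with hN
  have hNpos : 0 < N := by rw [hN]; positivity
  have h1 : N ≤ C * (16 * ((s : ℝ) * r) ^ 4) ^ 2 := by
    rw [pow_two N] at key
    exact le_of_mul_le_mul_right key hNpos
  have hlow : 32 * (s : ℝ) ^ 7 * (r : ℝ) ^ 9 ≤ N := by
    rw [hN]
    have e : 32 * (s : ℝ) ^ 7 * (r : ℝ) ^ 9 =
        (2 * ((s : ℝ) * r) ^ 3) * (4 * ((s : ℝ) ^ 2 * (r : ℝ) ^ 3)) ^ 2 := by ring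
    rw [e]
    have u1 : 2 * ((s : ℝ) * r) ^ 3 ≤ 2 * ((s : ℝ) * r) ^ 3 + 1 := by linarith
    have u2 : (4 * ((s : ℝ) ^ 2 * (r : ℝ) ^ 3)) ^ 2 ≤ (4 * ((s : ℝ) ^ 2 * (r : ℝ) ^ 3) + 1) ^ 2 :=
      pow_le_pow_left₀ (by positivity) (by linarith) 2
    exact mul_le_mul u1 u2 (by positivity) (by positivity)
  have hup : C * (16 * ((s : ℝ) * r) ^ 4) ^ 2 ≤ 256 * |C| * (s : ℝ) ^ 8 * (r : ℝ) ^ 8 := by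
    have e : (16 * ((s : ℝ) * r) ^ 4) ^ 2 = 256 * (s : ℝ) ^ 8 * (r : ℝ) ^ 8 := by ring
    rw [e]
    nlinarith [le_abs_self C, pow_nonneg hS0 8, pow_nonneg hr0 8,
      mul_nonneg (pow_nonneg hS0 8) (pow_nonneg hr0 8)]
  have hc := hlow.trans (h1.trans hup)
  -- 32 s^7 r^9 ≤ 256 |C| s^8 r^8  ⇒  r ≤ 8 |C| s
  have hpos : (0 : ℝ) < 32 * (s : ℝ) ^ 7 * (r : ℝ) ^ 8 := by positivity
  have e1 : 32 * (s : ℝ) ^ 7 * (r : ℝ) ^ 9 = (r : ℝ) * (32 * (s : ℝ) ^ 7 * (r : ℝ) ^ 8) := by ring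
  have e2 : 256 * |C| * (s : ℝ) ^ 8 * (r : ℝ) ^ 8 = (8 * |C| * s) * (32 * (s : ℝ) ^ 7 * (r : ℝ) ^ 8) := by
    ring
  rw [e1, e2] at hc
  exact le_of_mul_le_mul_right hc hpos

/-- **C61b, rev-2 face — Theorem 4.2 (25) first half fails in the CONE reading at every fixed aperture.**
[cite: AbuGhuwaleh2026b, Thm 4.2 (25) p.10; §4 p.9 l.77–90; §6.1 p.19 l.14] -/
theorem not_Step2T_Thm42_25a : ¬ Step2T_Thm42_25a := by
  intro h
  -- aperture 1 already fails (any fixed `s ≥ 1` does; `s = 1` is the widest square-cone)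
  obtain ⟨C, hC⟩ := h 1 one_pos 1 one_pos le_rfl
  have hb := thin_bound C 1 le_rfl hC (8 * (Nat.ceil |C| + 1)) (by omega)
  push_cast at hb
  have hc : |C| ≤ (Nat.ceil |C| : ℝ) := Nat.le_ceil _
  linarith [abs_nonneg C]

/-- The same at an arbitrary fixed aperture `1/s` (the per-class constant may depend on `s`):
no single `C` works for the class of aperture `1/s`. [cite: AbuGhuwaleh2026b, Thm 4.2 (25) p.10] -/
theorem not_thinClass_bound (s : ℕ) (hs : 1 ≤ s) (C : ℝ) :
    ¬ (∀ R : ℝ, 1 ≤ R → ∀ (A : Finset Z3) (a : Z3 → ℝ),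
      (∀ p ∈ A, lnorm p ≤ 1 * R ^ (3 / 4 : ℝ)) → (∀ p ∈ A, p ∈ thinClass s) →
        (∑ p ∈ A, |a p|) ^ 2 ≤ C * R ^ 2 * ∑ p ∈ A, a p ^ 2) := by
  intro hC
  have hb := thin_bound C s hs hC (8 * s * (Nat.ceil |C| + 1)) (by nlinarith)
  push_cast at hb
  have hc : |C| ≤ (Nat.ceil |C| : ℝ) := Nat.le_ceil _
  have hS1 : (1 : ℝ) ≤ s := by exact_mod_cast hs
  nlinarith [abs_nonneg C]

end

end Summit.NavierStokesRegularity.NavierStokesRegularity.Theorems.AbuGhuwaleh2026b
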